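import Summits.ResolutionOfSingularities.ResolutionOfSingularities.Theorems.MarkedTransferCampaignW46LooseThread
import Summits.ResolutionOfSingularities.ResolutionOfSingularities.Theorems.MarkedTransferCampaignW46ThreadChainValuation
import HarnessLib

/-!
# [OURS · L1 W4.6 rung (i-b)] Loose thread chains, II: the valuation ring of the chain, `O = ⋃ R k`, principalization
# (cell res-hironaka, LADDER-RESOLUTION rung L, D-0089; campaign s46, prover res-L1-s46-pv-1; host route MarkedTransfer,
# `--supports stmt-ResolutionOfSingularities-16155`)

HONEST FRAMING. Nothing here is a statement of H. Hironaka's manuscript (2017-03-23, [Hironaka2017]). Pure commutative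
algebra inside a field `F` about the loose thread chains `IsLooseThreadChain b m R J` of
`MarkedTransferCampaignW46LooseThread.lean` — the same facts as `MarkedTransferCampaignW46ThreadChainValuation.lean` (rung
(i-a), `m ≡ b`) with the loose transform law `x^{m k} · J (k+1) = J k · R (k+1)`. AI review is weaker than expert review.
No `sorry`; axioms standard.

## Contents

* `ringKrullDim_eq_two` — every member has dimension exactly `2` (the curve/point cases are excluded).
* `exists_valuationSubring`, `along`, `mem_iff_exists_mem` (`O = ⋃ R k`, Abhyankar), `exists_finset_subset`.
* `exists_span_mul_eq_extIdeal_of_le` — the cumulative loose law `P · J k = J N · R k`, `P ≠ 0` (`N ≤ k`).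
* `exists_forall_isPrincipal` — `J k` is principal for all large `k`.

## References

* O. Zariski, P. Samuel, *Commutative Algebra* II (1960), Ch. VI §4 Thm. 5; Appendix 5. [ZariskiSamuel1960]
* S. S. Abhyankar, Amer. J. Math. 78 (1956), Lemma 12. [Abhyankar1956Valuations]
-/

noncomputable section

set_option linter.dupNamespace false -- mandated namespace of this single-conjunct summit

open IsLocalRing

namespace Summit.ResolutionOfSingularities.ResolutionOfSingularities.Theorems

namespace CampaignW46

open Literature.AlgebraicGeometry.Resolution

universe u

variable {F : Type u} [Field F]

namespace IsLooseThreadChain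

variable {b : ℕ} {m : ℕ → ℕ} {R : ℕ → Subring F} {J : ∀ k, Ideal (R k)}

/-! ## All members are two-dimensional; the valuation ring of the chain -/

/-- Every member of a loose thread chain has dimension exactly `2`. [folklore] -/
theorem ringKrullDim_eq_two (h : IsLooseThreadChain b m R J) (k : ℕ) : ringKrullDim (R k) = 2 := by
  haveI := h.isRegularLocalRing k
  obtain ⟨e, he⟩ := WithBot.ne_bot_iff_exists.mp (ringKrullDim_ne_bot (R := R k))
  have het : e ≠ ⊤ := fun ht => ringKrullDim_ne_top (R := R k) (by rw [← he, ht]; rfl)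
  obtain ⟨d, rfl⟩ := ENat.ne_top_iff_exists.mp het
  have h2 := h.ringKrullDim_le k
  rw [← he] at h2
  have hd2 : d ≤ 2 := by
    have hA : ((d : ℕ∞) : WithBot ℕ∞) ≤ ((2 : ℕ∞) : WithBot ℕ∞) := h2
    have hB : (d : ℕ∞) ≤ (2 : ℕ) := WithBot.coe_le_coe.mp hA
    exact ENat.coe_le_coe.mp hB
  rcases Nat.lt_or_ge d 2 with hlt | hge
  · exact (h.false_of_ringKrullDim_le_one (k₀ := k) (by rw [← he]; exact_mod_cast Nat.le_of_lt_succ hlt)).elim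
  · rw [← he]
    have : d = 2 := le_antisymm hd2 hge
    rw [this]; rfl

/-- **The valuation ring of a loose thread chain** (Chevalley): some valuation ring `O` of `F` dominates every member.
[cite: ZariskiSamuel1960, Ch. VI §4, Thm. 5] -/
theorem exists_valuationSubring (h : IsLooseThreadChain b m R J) :
    ∃ O : ValuationSubring F, ∀ k, SubringDominates (R k) O.toSubring :=
  exists_valuationSubring_subringDominates_chain R (fun k => (h.isRegularLocalRing k).toIsLocalRing)
    fun k => (h.isQuadraticTransform k).dominates

/-- Every step of a loose thread chain is the quadratic transform ALONG any valuation ring dominating the chain.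
[cite: Cutkosky2014, §2.2] -/
theorem along (h : IsLooseThreadChain b m R J) {O : ValuationSubring F}
    (hO : ∀ k, SubringDominates (R k) O.toSubring) (k : ℕ) : IsQuadraticTransformAlong O (R k) (R (k + 1)) := by
  haveI := h.isRegularLocalRing k
  exact (h.isQuadraticTransform k).along ⟨inferInstance, IsNoetherian.noetherian _⟩ (hO (k + 1))

/-- **`O = ⋃ R k`** for a loose thread chain (Abhyankar's union lemma, tree `AbhyankarQuadraticUnion_holds`).
[cite: Abhyankar1956Valuations, Lemma 12] -/
theorem mem_iff_exists_mem (h : IsLooseThreadChain b m R J) {O : ValuationSubring F}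
    (hO : ∀ k, SubringDominates (R k) O.toSubring) (z : F) : z ∈ O ↔ ∃ k, z ∈ R k :=
  AbhyankarQuadraticUnion_holds F O R (h.isRegularLocalRing 0) (h.ringKrullDim_eq_two 0) h.isLocalRingOf (hO 0)
    (h.along hO) z

/-- A finite set of elements of `O` lies in some member of a loose thread chain. [folklore] -/
theorem exists_finset_subset (h : IsLooseThreadChain b m R J) {O : ValuationSubring F}
    (hO : ∀ k, SubringDominates (R k) O.toSubring) (S : Finset F) (hS : ∀ z ∈ S, z ∈ O) :
    ∃ k, ∀ z ∈ S, z ∈ R k := by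
  classical
  choose! ι hι using fun z (hz : z ∈ S) => (h.mem_iff_exists_mem hO z).mp (hS z hz)
  exact ⟨S.sup ι, fun z hz => h.mono (Finset.le_sup hz) (hι z hz)⟩

/-! ## Principalization along the chain -/

/-- **Cumulative loose law**: `P · J k = J N · R k` for some non-zero `P ∈ R k` (`N ≤ k`; `P` is the product of the
`x_i^{m i}`). [folklore] -/
theorem exists_span_mul_eq_extIdeal_of_le (h : IsLooseThreadChain b m R J) {N : ℕ} : ∀ {k : ℕ}, N ≤ k →
    ∃ P : R k, P ≠ 0 ∧ Ideal.span {P} * J k = extIdeal (J N) (R k) := by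
  intro k hNk
  induction k, hNk using Nat.le_induction with
  | base => exact ⟨1, one_ne_zero, by rw [Ideal.span_singleton_one, Ideal.top_mul, extIdeal_self]⟩
  | succ k hNk ih =>
    obtain ⟨P, hP0, hP⟩ := ih
    obtain ⟨x, hxR, hx0, -, -, hx1, hmx⟩ := h.exists_generator k
    have hprod := h.span_pow_mul_eq k hx1 hmx
    refine ⟨Subring.inclusion (h.le_succ k) P * (⟨x, hx1⟩ : R (k + 1)) ^ m k, ?_, ?_⟩
    · refine mul_ne_zero ?_ (pow_ne_zero _ fun e => hx0 (congrArg Subtype.val e))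
      exact fun e => hP0 (Subring.inclusion_injective _ (by rw [e, map_zero]))
    · rw [← Ideal.span_singleton_mul_span_singleton, mul_assoc, hprod, extIdeal_eq_map _ (h.le_succ k),
        ← map_extIdeal (J N) (h.mono hNk) (h.le_succ k), ← hP, Ideal.map_mul, Ideal.map_span,
        Set.image_singleton]

/-- **Principalization**: in a loose thread chain `J k` is principal for all large `k`. A generator `g₀` of `J 0` of
extreme value divides the others in `O = ⋃ R i`, hence in some `R N`, so `J 0 · R k = g₀ R k` for `k ≥ N`; and
`P · J k = J 0 · R k` with `P ≠ 0` in the domain `R k`. [cite: ZariskiSamuel1960, Appendix 5] -/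
theorem exists_forall_isPrincipal (h : IsLooseThreadChain b m R J) : ∃ N, ∀ k, N ≤ k → (J k).IsPrincipal := by
  classical
  obtain ⟨O, hO⟩ := h.exists_valuationSubring
  haveI := h.isRegularLocalRing 0
  obtain ⟨s, hs⟩ := (IsNoetherian.noetherian (J 0) : (J 0).FG)
  have hsne : (s.filter fun g : R 0 => (g : F) ≠ 0).Nonempty := by
    by_contra hempty
    rw [Finset.not_nonempty_iff_eq_empty, Finset.filter_eq_empty_iff] at hempty
    apply h.ne_bot 0
    rw [← hs, Ideal.span_eq_bot]
    intro g hg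
    have := hempty hg
    push Not at this
    exact Subtype.ext this
  obtain ⟨g₀, hg₀s, hmax⟩ := Finset.exists_max_image (s.filter fun g : R 0 => (g : F) ≠ 0)
    (fun g => O.valuation (g : F)) hsne
  obtain ⟨hg₀s', hg₀0⟩ := Finset.mem_filter.mp hg₀s
  have hg₀J : g₀ ∈ J 0 := hs ▸ Ideal.subset_span hg₀s'
  have hdivO : ∀ g ∈ s, (g : F) / (g₀ : F) ∈ O := by
    intro g hg
    by_cases hg0 : (g : F) = 0
    · rw [hg0, zero_div]; exact O.zero_mem
    · rw [← O.valuation_le_one_iff, map_div₀, div_le_one₀ (pos_iff_ne_zero.mpr ((map_ne_zero _).mpr hg₀0))]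
      exact hmax g (Finset.mem_filter.mpr ⟨hg, hg0⟩)
  obtain ⟨N, hN⟩ := h.exists_finset_subset hO (s.image fun g : R 0 => (g : F) / (g₀ : F)) (by
    intro z hz
    obtain ⟨g, hg, rfl⟩ := Finset.mem_image.mp hz
    exact hdivO g hg)
  refine ⟨N, fun k hk => ?_⟩
  haveI := h.isRegularLocalRing k
  have hle : R 0 ≤ R k := h.mono (Nat.zero_le k)
  -- `J 0 · R k = g₀ R k`
  have hext : extIdeal (J 0) (R k) = Ideal.span {Subring.inclusion hle g₀} := by
    apply le_antisymm
    · rw [← hs, extIdeal_eq_map _ hle, Ideal.map_span, Ideal.span_le]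
      rintro _ ⟨g, hg, rfl⟩
      rw [SetLike.mem_coe, Ideal.mem_span_singleton']
      have hq : (g : F) / (g₀ : F) ∈ R k :=
        h.mono hk (hN _ (Finset.mem_image.mpr ⟨g, Finset.mem_coe.mp hg, rfl⟩))
      refine ⟨⟨(g : F) / (g₀ : F), hq⟩, Subtype.ext ?_⟩
      change (g : F) / (g₀ : F) * (g₀ : F) = (g : F)
      rw [div_mul_cancel₀ _ hg₀0]
    · rw [Ideal.span_singleton_le_iff_mem, extIdeal_eq_map _ hle]
      exact Ideal.mem_map_of_mem _ hg₀J
  obtain ⟨P, hP0, hP⟩ := h.exists_span_mul_eq_extIdeal_of_le (Nat.zero_le k)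
  rw [hext] at hP
  exact (isPrincipal_span_singleton_mul_iff hP0 (J k)).mp ⟨⟨_, hP.trans (Ideal.submodule_span_eq).symm⟩⟩

end IsLooseThreadChain

end CampaignW46

end Summit.ResolutionOfSingularities.ResolutionOfSingularities.Theorems

end
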